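import Mathlib
import Literature.Combinatorics.Optimization.SDPFormulationFactorization
import Literature.Combinatorics.Optimization.PsdRankBasicProperties
import HarnessLib

/-!
# Reductions between SDP formulations of optimization problems (Braun–Pokutta–Zink 2015, Braun–Pokutta–Roy 2016)

G. Braun, S. Pokutta, D. Zink, *Inapproximability of combinatorial problems via small LPs and SDPs*,
STOC 2015 [BraunPokuttaZink2015] (held `paper:arxiv-1410.8816`, §3–§4), and G. Braun, S. Pokutta, A. Roy,
*Strong reductions for extended formulations*, IPCO 2016 / Math. Program. 172 (2018) [BraunPokuttaRoy2016]
(arXiv:1512.04932v3; locators "Def./Thm. n" below are the arXiv v3 numbering: §2.2 framework, §3 reductions).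

The tree already TYPES the Braun–Pokutta–Zink framework — `MaxProblem σ φ` (a maximization problem
`𝒫 = (𝒮, 𝔍, val)` with completeness/soundness guarantees `C, S`), `MaxProblem.Sound` ("`max val_𝔍 ≤ S(𝔍)`"),
`SDPFormulation P d` (BPR16 Def. 2.24 = BBHPRRWZ Def. 2.2, a `(C,S)`-approximate SDP formulation of size `d`)
in `SymmetricSDPMatching.lean` — and PROVES the hard direction of the factorization theorem,
`SDPFormulation.hasPsdFactorization_slack` (an SDP formulation of size `d` gives a psd factorization of size
`d + 1` of the slack matrix), in `SDPFormulationFactorization.lean`.  This file adds, all PROVED (no named facts):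

* `MaxProblem.slackMatrix` — **Def. 2.25** "the `(C,S)`-approximate slack matrix `M_{𝒫,C,S}(𝔍, s) =
  C(𝔍) − val_𝔍(s)`", an `𝔍^S × 𝒮` matrix (rows: the sound instances `max val_𝔍 ≤ S(𝔍)`; `τ = +1`, maximization).
* `SDPFormulation.ofPsdFactorization`, `SDPFormulation.nonempty_of_hasPsdFactorization` — the converse
  ("Conversely, …") half of the **Factorization theorem, Thm. 2.26 = [BPZ15, Thm. 3.5] (via Thm. 2.20)**:
  a psd factorization `C(𝔍) − val_𝔍(s) = Tr[A_𝔍 B_s]` of size `r` IS an SDP formulation of size `r` (the SDP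
  is the whole cone `𝕊^r_+`, `X^s = B_s`, `w_𝔍(X) = C(𝔍) − Tr[A_𝔍 X]`).  Together with the tree's direction this is
  the printed `fc_⊕(𝒫, C, S) = rk_SDP M_{𝒫,C,S}` in the currency `rk_psd`:
  `fc_⊕ ≤ rk_psd(M_{𝒫,C,S}) ≤ fc_⊕ + 1` (Remark 2.19: SDP rank and psd rank differ by at most one — the tree's
  `HasPsdFactorization` has no separate "`+ u_𝔍`" summand, the `+1` carries it), stated as
  `SDPFormulation.isEmpty_of_not_hasPsdFactorization` / `SDPFormulation.not_hasPsdFactorization_of_isEmpty`.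
* `MaxProblem.Reduction P₁ P₂` — **Def. 3.1** (reduction "respecting the guarantees", the case of two
  MAXIMIZATION problems, `τ₁ = τ₂ = +1`): maps `* : 𝔍₁ → 𝔍₂`, `* : 𝒮₁ → 𝒮₂` and two entrywise nonnegative
  `𝔍₁ × 𝒮₁` matrices `M₁, M₂` with
  `C₁(𝔍₁) − val_{𝔍₁}(s₁) = [C₂(𝔍₁*) − val_{𝔍₁*}(s₁*)]·M₁(𝔍₁,s₁) + M₂(𝔍₁,s₁)` (eq. (3.1-complete)) and
  `OPT(𝔍₁*) ≤ S₂(𝔍₁*)` whenever `OPT(𝔍₁) ≤ S₁(𝔍₁)` (eq. (3.1-sound)).  [BPZ15]'s affine reductions are the case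
  `M₁ = ` a nonnegative constant per row, `M₂ = ` a nonnegative constant per row (`Reduction.affine`).
* `MaxProblem.Reduction.hasPsdFactorization_slackMatrix` — **Thm. 3.2, SDP clause** ("`fc_⊕(𝒫₁) ≤ rk_SDP M₂ +
  rk_SDP M₁ + rk_psd M₁ · fc_⊕(𝒫₂)`") in psd-rank currency:
  `rk_psd(M_{𝒫₁}) ≤ rk_psd(M₁)·rk_psd(M_{𝒫₂}) + rk_psd(M₂)` (its proof: eq. (3.1-complete) reads
  `M_{𝒫₁} = (F_𝔍 M_{𝒫₂} F_𝒮) ∘ M₁ + M₂`; Hadamard products multiply psd ranks (the tree's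
  `HasPsdFactorization.kronecker` restricted to the diagonal), sums add them, row/column maps are free);
  at formulation level `Reduction.hasPsdFactorization_of_sdpFormulation`,
  `Reduction.isEmpty_sdpFormulation` (how LOWER bounds travel: no psd factorization of `M_{𝒫₁}` of size
  `(d+1)·r₁ + r₂` ⇒ no SDP formulation of `𝒫₂` of size `d`), `Reduction.sdpFormulation` (an SDP formulation
  of `𝒫₂` of size `d` yields one of `𝒫₁` of size `(d+1)·r₁ + r₂`), and the affine specialisations
  (`r₁ = r₂ = 1`).

Not here: the LP clauses (the tree's LP factorization theorem is the polytope-level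
`Literature.Barriers.PneNP.HasEFOfSize.exists_nonneg_factorisation`, not a `MaxProblem` LP formulation);
minimization problems (`τ = −1`) and BPR16 §4 (fractional problems); the nonnegativity-problem layer
§2.2.3 (Defs. 2.14–2.17, Thm. 2.20/2.22), of which the optimization-problem statements here are the printed
special case "`𝒫_{C,S} = (𝒮, 𝔍^S, C − val)`" (§2.2.4).
-/

noncomputable section

open Matrix Finset
open scoped MatrixOrder

namespace Literature.Combinatorics.Optimization

variable {σ φ σ₁ φ₁ σ₂ φ₂ : Type*}

/-! ### The slack matrix of a maximization problem (Def. 2.25) -/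

namespace MaxProblem

/-- **The `(C,S)`-approximate slack matrix** of a maximization problem: the `𝔍^S × 𝒮` matrix
`M_{𝒫,C,S}(𝔍, s) = C(𝔍) − val_𝔍(s)`, rows indexed by the sound instances `𝔍 ∈ 𝔍^S`
(`max_s val_𝔍(s) ≤ S(𝔍)`). [cite: BraunPokuttaRoy2016, Def. 2.25 (arXiv v3, §2.2.4)] -/
def slackMatrix (P : MaxProblem σ φ) : {f : φ // P.Sound f} → σ → ℝ :=
  fun f s => P.C f.1 - P.val f.1 s

/-- Entries of the slack matrix. [cite: BraunPokuttaRoy2016, Def. 2.25 (arXiv v3, §2.2.4)] -/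
@[simp] theorem slackMatrix_apply (P : MaxProblem σ φ) (f : {f : φ // P.Sound f}) (s : σ) :
    P.slackMatrix f s = P.C f.1 - P.val f.1 s := rfl

end MaxProblem

/-! ### The factorization theorem, both directions (Thm. 2.26 = BPZ15 Thm. 3.5) -/

variable {d : ℕ}

/-- Factorization theorem, direction "formulation ⇒ factorization" (the tree's
`SDPFormulation.hasPsdFactorization_slack`, restated on `MaxProblem.slackMatrix`): an SDP formulation of size
`d` gives a psd factorization of the slack matrix of size `d + 1`.
[cite: BraunPokuttaRoy2016, Thm. 2.26 (arXiv v3)] [cite: BraunPokuttaZink2015, Thm. 3.5] -/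
theorem SDPFormulation.hasPsdFactorization_slackMatrix {P : MaxProblem σ φ} (E : SDPFormulation P d) :
    HasPsdFactorization P.slackMatrix (d + 1) :=
  E.hasPsdFactorization_slack

/-- `Y ↦ Tr[G Y]` as a linear functional on `r × r` real matrices. [folklore] -/
private def trMul {r : ℕ} (G : Matrix (Fin r) (Fin r) ℝ) : Matrix (Fin r) (Fin r) ℝ →ₗ[ℝ] ℝ where
  toFun Y := (G * Y).trace
  map_add' Y Z := by simp only [Matrix.mul_add, trace_add]
  map_smul' a Y := by simp only [Matrix.mul_smul, trace_smul, smul_eq_mul, RingHom.id_apply]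

/-- Unfolding `trMul`. [folklore] -/
@[simp] private theorem trMul_apply {r : ℕ} (G Y : Matrix (Fin r) (Fin r) ℝ) :
    trMul G Y = (G * Y).trace := rfl

/-- `Tr[A B] ≥ 0` for real psd `A, B` (`= Tr[A^{1/2} B A^{1/2}]`). [folklore] -/
private theorem trace_mul_nonneg_psd {r : ℕ} {A B : Matrix (Fin r) (Fin r) ℝ}
    (hA : A.PosSemidef) (hB : B.PosSemidef) : 0 ≤ (A * B).trace := by
  set S : Matrix (Fin r) (Fin r) ℝ := CFC.sqrt A with hS
  have hSpsd : S.PosSemidef := (CFC.sqrt_nonneg A).posSemidef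
  have hSS : S * S = A := CFC.sqrt_mul_sqrt_self A hA.nonneg
  have hSH : Sᴴ = S := hSpsd.1
  have hM : (S * B * Sᴴ).PosSemidef := hB.mul_mul_conjTranspose_same S
  have htrM : (S * B * Sᴴ).trace = (A * B).trace := by
    rw [hSH, Matrix.mul_assoc, trace_mul_comm, Matrix.mul_assoc, hSS, trace_mul_comm]
  rw [← htrM]
  exact hM.trace_nonneg

/-- **Factorization theorem, direction "factorization ⇒ formulation"** (the "Conversely" half of the
printed proof of Thm. 2.20, specialised to `𝒫_{C,S}` as in §2.2.4): a psd factorization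
`C(𝔍) − val_𝔍(s) = Tr[A_𝔍 B_s]` (`A_𝔍, B_s ∈ 𝕊^r_+`, `𝔍` sound) IS a `(C,S)`-approximate SDP formulation of
size `r`: the semidefinite program is the whole cone `{X ∈ 𝕊^r_+}` (no equations, `k = 0`), a feasible
solution `s` is realised by `X^s = B_s`, a sound instance by the affine function `w_𝔍(X) = C(𝔍) − Tr[A_𝔍 X]`
(exact on the `X^s` by the factorization; `≤ C(𝔍)` on the cone since `Tr[A_𝔍 X] ≥ 0`), an unsound instance by
anything (the definition constrains sound instances only; we take `w_𝔍 = 0`, `c_𝔍 = C(𝔍)`).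
[cite: BraunPokuttaRoy2016, Thm. 2.26 and proof of Thm. 2.20 (arXiv v3)] [cite: BraunPokuttaZink2015, Thm. 3.5] -/
def SDPFormulation.ofPsdFactorization (P : MaxProblem σ φ) {r : ℕ}
    (A : {f : φ // P.Sound f} → Matrix (Fin r) (Fin r) ℝ) (B : σ → Matrix (Fin r) (Fin r) ℝ)
    (hA : ∀ f, (A f).PosSemidef) (hB : ∀ s, (B s).PosSemidef)
    (hM : ∀ f s, P.slackMatrix f s = (A f * B s).trace) : SDPFormulation P r := by
  classical
  exact
  { k := 0
    A := 0
    b := 0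
    X := B
    posSemidef_X := hB
    A_X := fun s => Subsingleton.elim _ _
    w := fun f => if h : P.Sound f then -trMul (A ⟨f, h⟩) else 0
    c := fun f => P.C f
    exact := fun f hf s => by
      have h := hM ⟨f, hf⟩ s
      simp only [MaxProblem.slackMatrix_apply] at h
      simp only [dif_pos hf, LinearMap.neg_apply, trMul_apply]
      linarith
    achieves := fun f hf Y hY _ => by
      simp only [dif_pos hf, LinearMap.neg_apply, trMul_apply]
      have := trace_mul_nonneg_psd (hA ⟨f, hf⟩) hY
      linarith }

/-- Hence: a psd factorization of the slack matrix of size `r` gives an SDP formulation of size `r`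
(`fc_⊕(𝒫, C, S) ≤ rk_psd(M_{𝒫,C,S})`).
[cite: BraunPokuttaRoy2016, Thm. 2.26 (arXiv v3)] [cite: BraunPokuttaZink2015, Thm. 3.5] -/
theorem SDPFormulation.nonempty_of_hasPsdFactorization {P : MaxProblem σ φ} {r : ℕ}
    (h : HasPsdFactorization P.slackMatrix r) : Nonempty (SDPFormulation P r) := by
  obtain ⟨A, B, hA, hB, hM⟩ := h
  exact ⟨SDPFormulation.ofPsdFactorization P A B hA hB hM⟩

/-- Contrapositive of the previous: if `𝒫` has no SDP formulation of size `r`, its slack matrix has no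
psd factorization of size `r`. [cite: BraunPokuttaRoy2016, Thm. 2.26 (arXiv v3)] -/
theorem SDPFormulation.not_hasPsdFactorization_of_isEmpty {P : MaxProblem σ φ} {r : ℕ}
    (h : IsEmpty (SDPFormulation P r)) : ¬ HasPsdFactorization P.slackMatrix r :=
  fun hf => (SDPFormulation.nonempty_of_hasPsdFactorization hf).elim fun E => h.elim E

/-- How lower bounds are read off (the tree's direction, contrapositive): if the slack matrix has no psd
factorization of size `d + 1`, then `𝒫` has no `(C,S)`-approximate SDP formulation of size `d`
(`rk_psd(M_{𝒫,C,S}) ≤ fc_⊕(𝒫,C,S) + 1`, Remark 2.19).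
[cite: BraunPokuttaRoy2016, Thm. 2.26 and Remark 2.19 (arXiv v3)] [cite: BraunPokuttaZink2015, Thm. 3.5] -/
theorem SDPFormulation.isEmpty_of_not_hasPsdFactorization {P : MaxProblem σ φ}
    (h : ¬ HasPsdFactorization P.slackMatrix (d + 1)) : IsEmpty (SDPFormulation P d) :=
  ⟨fun E => h E.hasPsdFactorization_slackMatrix⟩

/-! ### Reductions (Def. 3.1) -/

/-- **Def. 3.1 (reduction from `𝒫₁` to `𝒫₂` respecting the guarantees `(C₁,S₁)`, `(C₂,S₂)`)**, for two
maximization problems: "two mappings `* : 𝔍₁ → 𝔍₂` and `* : 𝒮₁ → 𝒮₂` translating instances and feasible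
solutions independently; two nonnegative `𝔍₁ × 𝒮₁` matrices `M₁, M₂`" subject to
(3.1-complete) `C₁(𝔍₁) − val_{𝔍₁}(s₁) = [C₂(𝔍₁*) − val_{𝔍₁*}(s₁*)]·M₁(𝔍₁,s₁) + M₂(𝔍₁,s₁)` and
(3.1-sound) `OPT(𝔍₁*) ≤ S₂(𝔍₁*)` if `OPT(𝔍₁) ≤ S₁(𝔍₁)`.
[cite: BraunPokuttaRoy2016, Def. 3.1 (arXiv v3, §3)] [cite: BraunPokuttaZink2015, Def. 4.1 and Cor. 4.4 (affine reductions)] -/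
structure MaxProblem.Reduction (P₁ : MaxProblem σ₁ φ₁) (P₂ : MaxProblem σ₂ φ₂) where
  /-- the instance map `𝔍₁ ↦ 𝔍₁*` -/
  inst : φ₁ → φ₂
  /-- the solution map `s₁ ↦ s₁*` -/
  sol : σ₁ → σ₂
  /-- the matrix `M₁` -/
  M₁ : φ₁ → σ₁ → ℝ
  /-- the matrix `M₂` -/
  M₂ : φ₁ → σ₁ → ℝ
  /-- `M₁ ≥ 0` entrywise -/
  M₁_nonneg : ∀ f s, 0 ≤ M₁ f s
  /-- `M₂ ≥ 0` entrywise -/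
  M₂_nonneg : ∀ f s, 0 ≤ M₂ f s
  /-- (3.1-complete) -/
  complete : ∀ f s,
    P₁.C f - P₁.val f s = (P₂.C (inst f) - P₂.val (inst f) (sol s)) * M₁ f s + M₂ f s
  /-- (3.1-sound) -/
  sound : ∀ f, P₁.Sound f → P₂.Sound (inst f)

namespace MaxProblem.Reduction

variable {P₁ : MaxProblem σ₁ φ₁} {P₂ : MaxProblem σ₂ φ₂}

/-- The affine reductions of Braun–Pokutta–Zink (the case "`M₁`, `M₂` constant along each row"): maps
`*` with `C₁(𝔍₁) − val_{𝔍₁}(s₁) = λ(𝔍₁)·[C₂(𝔍₁*) − val_{𝔍₁*}(s₁*)] + μ(𝔍₁)`, `λ, μ ≥ 0`, and the soundness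
transfer. [cite: BraunPokuttaZink2015, Def. 4.1 and Cor. 4.4 (affine reductions)] [cite: BraunPokuttaRoy2016, Def. 3.1 (arXiv v3)] -/
def affine (inst : φ₁ → φ₂) (sol : σ₁ → σ₂) (lam mu : φ₁ → ℝ) (hlam : ∀ f, 0 ≤ lam f)
    (hmu : ∀ f, 0 ≤ mu f)
    (hcomplete : ∀ f s,
      P₁.C f - P₁.val f s = lam f * (P₂.C (inst f) - P₂.val (inst f) (sol s)) + mu f)
    (hsound : ∀ f, P₁.Sound f → P₂.Sound (inst f)) : P₁.Reduction P₂ where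
  inst := inst
  sol := sol
  M₁ f _ := lam f
  M₂ f _ := mu f
  M₁_nonneg f _ := hlam f
  M₂_nonneg f _ := hmu f
  complete f s := by rw [hcomplete f s, mul_comm]
  sound := hsound

/-- The instance map restricted to sound instances (3.1-sound).
[cite: BraunPokuttaRoy2016, Def. 3.1 (arXiv v3)] -/
def instSound (R : P₁.Reduction P₂) : {f : φ₁ // P₁.Sound f} → {f : φ₂ // P₂.Sound f} :=
  fun f => ⟨R.inst f.1, R.sound f.1 f.2⟩

/-- Eq. (3.1-complete) at the level of slack matrices: `M_{𝒫₁} = (F_𝔍 M_{𝒫₂} F_𝒮) ∘ M₁ + M₂` (the first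
display of the proof of Thm. 2.22). [cite: BraunPokuttaRoy2016, proof of Thm. 2.22 (arXiv v3)] -/
theorem slackMatrix_eq (R : P₁.Reduction P₂) :
    P₁.slackMatrix = fun f s => P₂.slackMatrix (R.instSound f) (R.sol s) * R.M₁ f.1 s + R.M₂ f.1 s := by
  funext f s
  exact R.complete f.1 s

/-- Hadamard products multiply psd ranks: `rk_psd(A ∘ B) ≤ rk_psd(A)·rk_psd(B)` (Kronecker product restricted
to the diagonal; "the well-known identities" invoked in the proof of Thm. 2.22).
[cite: BraunPokuttaRoy2016, proof of Thm. 2.22 (arXiv v3)] -/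
theorem _root_.Literature.Combinatorics.Optimization.HasPsdFactorization.hadamard {ι κ : Type*}
    {A B : ι → κ → ℝ} {r s : ℕ} (hA : HasPsdFactorization A r) (hB : HasPsdFactorization B s) :
    HasPsdFactorization (fun i j => A i j * B i j) (r * s) :=
  (hA.kronecker hB).submatrix (fun i => (i, i)) (fun j => (j, j))

/-- **Thm. 3.2, SDP clause, in psd-rank currency:** given a reduction from `𝒫₁` to `𝒫₂`, psd factorizations
of `M_{𝒫₂,C₂,S₂}` (size `r`), of `M₁` (size `r₁`) and of `M₂` (size `r₂`, both restricted to the sound rows)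
give a psd factorization of `M_{𝒫₁,C₁,S₁}` of size `r·r₁ + r₂`
("`fc_⊕(𝒫₁) ≤ rk M₂ + … + rk_psd M₁ · fc_⊕(𝒫₂)`").
[cite: BraunPokuttaRoy2016, Thm. 3.2 via Thm. 2.22 (arXiv v3)] [cite: BraunPokuttaZink2015, Prop. 4.2 (reductions of formulations)] -/
theorem hasPsdFactorization_slackMatrix (R : P₁.Reduction P₂) {r r₁ r₂ : ℕ}
    (h₂ : HasPsdFactorization P₂.slackMatrix r)
    (h₁ : HasPsdFactorization (fun (f : {f : φ₁ // P₁.Sound f}) (s : σ₁) => R.M₁ f.1 s) r₁)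
    (hM₂ : HasPsdFactorization (fun (f : {f : φ₁ // P₁.Sound f}) (s : σ₁) => R.M₂ f.1 s) r₂) :
    HasPsdFactorization P₁.slackMatrix (r * r₁ + r₂) := by
  rw [R.slackMatrix_eq]
  exact ((h₂.submatrix R.instSound R.sol).hadamard h₁).add hM₂

/-- A matrix constant along rows with nonnegative entries, `M(𝔍, s) = λ(𝔍) ≥ 0`, has a psd factorization
of size `1`. [cite: BraunPokuttaRoy2016, proof of Thm. 2.22 (arXiv v3, "`diag(F_𝔍 a)·M₁`")] -/
theorem hasPsdFactorization_of_rowConst {ι κ : Type*} {M : ι → κ → ℝ} (lam : ι → ℝ)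
    (hM : ∀ i j, M i j = lam i) (hnn : ∀ i j, 0 ≤ M i j) : HasPsdFactorization M 1 := by
  rcases isEmpty_or_nonempty κ with hκ | ⟨⟨j₀⟩⟩
  · exact ⟨fun _ => 0, fun j => isEmptyElim j, fun _ => PosSemidef.zero, fun j => isEmptyElim j,
      fun _ j => isEmptyElim j⟩
  · refine HasPsdFactorization.of_nonnegFactorization (fun i _ => lam i) (fun _ _ => 1)
      (fun i _ => ?_) (fun _ _ => zero_le_one) (fun i j => by simp [hM i j])
    rw [← hM i j₀]
    exact hnn i j₀

/-- **Thm. 3.2 for affine reductions:** if `M₁`, `M₂` are constant along rows then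
`rk_psd(M_{𝒫₁}) ≤ rk_psd(M_{𝒫₂}) + 1`.
[cite: BraunPokuttaRoy2016, Thm. 3.2 (arXiv v3)] [cite: BraunPokuttaZink2015, Prop. 4.2 (reductions of formulations)] -/
theorem hasPsdFactorization_slackMatrix_affine (R : P₁.Reduction P₂) (lam mu : φ₁ → ℝ)
    (hM₁ : ∀ f s, R.M₁ f s = lam f) (hM₂ : ∀ f s, R.M₂ f s = mu f) {r : ℕ}
    (h₂ : HasPsdFactorization P₂.slackMatrix r) : HasPsdFactorization P₁.slackMatrix (r + 1) := by
  have h₁ : HasPsdFactorization (fun (f : {f : φ₁ // P₁.Sound f}) (s : σ₁) => R.M₁ f.1 s) 1 :=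
    hasPsdFactorization_of_rowConst (fun f => lam f.1) (fun f s => hM₁ f.1 s)
      (fun f s => R.M₁_nonneg f.1 s)
  have hμ : HasPsdFactorization (fun (f : {f : φ₁ // P₁.Sound f}) (s : σ₁) => R.M₂ f.1 s) 1 :=
    hasPsdFactorization_of_rowConst (fun f => mu f.1) (fun f s => hM₂ f.1 s)
      (fun f s => R.M₂_nonneg f.1 s)
  simpa using R.hasPsdFactorization_slackMatrix h₂ h₁ hμ

/-- **Thm. 3.2 at formulation level:** an SDP formulation of `𝒫₂` of size `d` and psd factorizations of
`M₁`, `M₂` (sizes `r₁`, `r₂`) give a psd factorization of `M_{𝒫₁}` of size `(d+1)·r₁ + r₂`.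
[cite: BraunPokuttaRoy2016, Thm. 3.2 (arXiv v3)] -/
theorem hasPsdFactorization_of_sdpFormulation (R : P₁.Reduction P₂) (E : SDPFormulation P₂ d)
    {r₁ r₂ : ℕ} (h₁ : HasPsdFactorization (fun (f : {f : φ₁ // P₁.Sound f}) (s : σ₁) => R.M₁ f.1 s) r₁)
    (hM₂ : HasPsdFactorization (fun (f : {f : φ₁ // P₁.Sound f}) (s : σ₁) => R.M₂ f.1 s) r₂) :
    HasPsdFactorization P₁.slackMatrix ((d + 1) * r₁ + r₂) :=
  R.hasPsdFactorization_slackMatrix E.hasPsdFactorization_slackMatrix h₁ hM₂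

/-- **Thm. 3.2, both factorization directions composed:** an SDP formulation of `𝒫₂` of size `d` yields an
SDP formulation of `𝒫₁` of size `(d+1)·r₁ + r₂`. [cite: BraunPokuttaRoy2016, Thm. 3.2 (arXiv v3)] -/
def sdpFormulation (R : P₁.Reduction P₂) (E : SDPFormulation P₂ d) {r₁ r₂ : ℕ}
    (h₁ : HasPsdFactorization (fun (f : {f : φ₁ // P₁.Sound f}) (s : σ₁) => R.M₁ f.1 s) r₁)
    (hM₂ : HasPsdFactorization (fun (f : {f : φ₁ // P₁.Sound f}) (s : σ₁) => R.M₂ f.1 s) r₂) :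
    SDPFormulation P₁ ((d + 1) * r₁ + r₂) :=
  Classical.choice
    (SDPFormulation.nonempty_of_hasPsdFactorization (R.hasPsdFactorization_of_sdpFormulation E h₁ hM₂))

/-- **How lower bounds travel along a reduction** (the use made of Thm. 3.2 throughout §5–§7): if
`M_{𝒫₁,C₁,S₁}` has no psd factorization of size `(d+1)·r₁ + r₂`, then `𝒫₂` has no `(C₂,S₂)`-approximate SDP
formulation of size `d`. [cite: BraunPokuttaRoy2016, Thm. 3.2 (arXiv v3)] -/
theorem isEmpty_sdpFormulation (R : P₁.Reduction P₂) {r₁ r₂ : ℕ}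
    (h₁ : HasPsdFactorization (fun (f : {f : φ₁ // P₁.Sound f}) (s : σ₁) => R.M₁ f.1 s) r₁)
    (hM₂ : HasPsdFactorization (fun (f : {f : φ₁ // P₁.Sound f}) (s : σ₁) => R.M₂ f.1 s) r₂)
    (hno : ¬ HasPsdFactorization P₁.slackMatrix ((d + 1) * r₁ + r₂)) :
    IsEmpty (SDPFormulation P₂ d) :=
  ⟨fun E => hno (R.hasPsdFactorization_of_sdpFormulation E h₁ hM₂)⟩

/-- Lower-bound transfer for affine reductions: no psd factorization of `M_{𝒫₁}` of size `d + 2` ⇒ no SDP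
formulation of `𝒫₂` of size `d`. [cite: BraunPokuttaRoy2016, Thm. 3.2 (arXiv v3)]
[cite: BraunPokuttaZink2015, Prop. 4.2 (reductions of formulations)] -/
theorem isEmpty_sdpFormulation_affine (R : P₁.Reduction P₂) (lam mu : φ₁ → ℝ)
    (hM₁ : ∀ f s, R.M₁ f s = lam f) (hM₂ : ∀ f s, R.M₂ f s = mu f)
    (hno : ¬ HasPsdFactorization P₁.slackMatrix (d + 2)) : IsEmpty (SDPFormulation P₂ d) :=
  ⟨fun E => hno (R.hasPsdFactorization_slackMatrix_affine lam mu hM₁ hM₂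
    E.hasPsdFactorization_slackMatrix)⟩

end MaxProblem.Reduction

end Literature.Combinatorics.Optimization

end
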